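import Summits.Ventures.PercRepro.RankDistSeriesDegenerate
import Summits.Ventures.PercRepro.RankDistCumulative

/-!
# PercRepro — THE ROW (SC) AND C-025 HOLD ON EVERY SERIES-DEGENERATE CELL (p9, gen 22)

`RankDistSeriesDegenerate`: on the tight layer with a series class `S` of the maximal size `k = |S| = p − q + 2`,
`s_u = c · C(k, u − q + 1)` for `q ≤ u < p` (`c = #𝓤₀`). The cumulative shadow inequality
`s_q · C(n, u) ≤ s_u · C(n, q)` (`ShadowCumulative M p q`, the row C-048 / (SC) of this lane) therefore reduces to the
BINOMIAL INEQUALITY `k · C(n, q + J) ≤ C(k, J + 1) · C(n, q)` with `n = 2q + k − 2` and `J = u − q ≤ k − 3`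
(`series_binom`): for `2J + 1 ≤ k` by induction on `J` — the step multiplies by `(q + J + 1)(J + 2)` and uses
`(q + k − 2 − J)(J + 2) ≤ (k − J − 1)(q + J + 1)`, i.e. `(q − 1)(k − 2J − 3) ≥ 0` (`series_binom_aux`) — and beyond
the middle by the reflection `J ↦ k − 2 − J`, under which both `C(n, q + J)` and `C(k, J + 1)` are symmetric.
Hence **`ShadowCumulative M p q` on every series-degenerate cell** (`shadowCumulative_of_series`) and, by
`rls_of_shadowCumulative`, **C-025 itself: `ThmN.RLS M p q`** (`rls_of_series`) — at EVERY `(p, q)`, inside the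
open windows included; equality at `q = 1` (the cell is `U_{k−1,k}` itself). The slack at `u = p − 1` is
`(k − 1)(q + 1) / (2(q + k − 2))` — exactly the minima of the census (`1.333` at `(16, 9, 7)`, `1.6` at
`(17, 10, 7)`, `1.667` at `(21, 12, 9)`). Nothing here moves any window of the crux: it is a family of matroids
at every `(p, q)`, not a window.
-/

namespace PercRepro.RankDist

open Set Finset _root_.Matroid PercRepro.ThmH

/-! ## The binomial inequality -/

/-- **The binomial inequality of the series-degenerate profile, below the middle**: `q ≥ 1`, `2J + 1 ≤ k`:
`k · C(2q + k − 2, q + J) ≤ C(k, J + 1) · C(2q + k − 2, q)`. -/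
lemma series_binom_aux (k q : ℕ) (hq : 1 ≤ q) : ∀ J, 2 * J + 1 ≤ k →
    k * (2 * q + k - 2).choose (q + J) ≤ k.choose (J + 1) * (2 * q + k - 2).choose q := by
  intro J
  induction J with
  | zero =>
    intro _
    rw [Nat.choose_one_right, Nat.add_zero]
  | succ j ih =>
    intro hj
    have ih' := ih (by omega)
    have h1 : (2 * q + k - 2).choose (q + j + 1) * (q + j + 1)
        = (2 * q + k - 2).choose (q + j) * (2 * q + k - 2 - (q + j)) :=
      Nat.choose_succ_right_eq (2 * q + k - 2) (q + j)
    have h2 : k.choose (j + 2) * (j + 2) = k.choose (j + 1) * (k - (j + 1)) :=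
      Nat.choose_succ_right_eq k (j + 1)
    have hkey : (2 * q + k - 2 - (q + j)) * (j + 2) ≤ (k - (j + 1)) * (q + j + 1) := by
      obtain ⟨q', rfl⟩ : ∃ q', q = q' + 1 := ⟨q - 1, by omega⟩
      obtain ⟨m, rfl⟩ : ∃ m, k = 2 * j + 3 + m := ⟨k - (2 * j + 3), by omega⟩
      have e1 : 2 * (q' + 1) + (2 * j + 3 + m) - 2 - (q' + 1 + j) = q' + j + 2 + m := by omega
      have e2 : 2 * j + 3 + m - (j + 1) = j + 2 + m := by omega
      rw [e1, e2]
      nlinarith [Nat.zero_le q', Nat.zero_le m, Nat.zero_le j]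
    have hpos : 0 < (q + j + 1) * (j + 2) := by positivity
    refine Nat.le_of_mul_le_mul_right ?_ hpos
    calc k * (2 * q + k - 2).choose (q + (j + 1)) * ((q + j + 1) * (j + 2))
        = k * ((2 * q + k - 2).choose (q + j + 1) * (q + j + 1)) * (j + 2) := by
          rw [← Nat.add_assoc]
          ring
      _ = k * (2 * q + k - 2).choose (q + j) * ((2 * q + k - 2 - (q + j)) * (j + 2)) := by
          rw [h1]
          ring
      _ ≤ k.choose (j + 1) * (2 * q + k - 2).choose q * ((k - (j + 1)) * (q + j + 1)) :=
          Nat.mul_le_mul ih' hkey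
      _ = (k.choose (j + 1) * (k - (j + 1))) * (2 * q + k - 2).choose q * (q + j + 1) := by ring
      _ = (k.choose (j + 2) * (j + 2)) * (2 * q + k - 2).choose q * (q + j + 1) := by rw [h2]
      _ = k.choose (j + 1 + 1) * (2 * q + k - 2).choose q * ((q + j + 1) * (j + 2)) := by ring

/-- **The binomial inequality of the series-degenerate profile**: `q ≥ 1`, `J + 3 ≤ k`:
`k · C(2q + k − 2, q + J) ≤ C(k, J + 1) · C(2q + k − 2, q)` (beyond the middle by the reflection `J ↦ k − 2 − J`). -/
lemma series_binom (k q : ℕ) (hq : 1 ≤ q) {J : ℕ} (hJ : J + 3 ≤ k) :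
    k * (2 * q + k - 2).choose (q + J) ≤ k.choose (J + 1) * (2 * q + k - 2).choose q := by
  by_cases h : 2 * J + 1 ≤ k
  · exact series_binom_aux k q hq J h
  · have h1 : (2 * q + k - 2).choose (q + J) = (2 * q + k - 2).choose (q + (k - 2 - J)) := by
      rw [← Nat.choose_symm (by omega : q + J ≤ 2 * q + k - 2)]
      congr 1
      omega
    have h2 : k.choose (J + 1) = k.choose (k - 2 - J + 1) := by
      rw [← Nat.choose_symm (by omega : J + 1 ≤ k)]
      congr 1
      omega
    rw [h1, h2]
    exact series_binom_aux k q hq (k - 2 - J) (by omega)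

/-! ## The row (SC) and C-025 on the series-degenerate cells -/

variable {α : Type} (M : Matroid α) [M.Finite] [DecidableEq α]

/-- **THE CUMULATIVE SHADOW INEQUALITY HOLDS ON EVERY SERIES-DEGENERATE CELL**: `|E| = p + q`, `ρ(E) = p`, `S` a
series class (every two elements a cocircuit, no coloops) with `|S| + q = p + 2`:
`s_q · C(p + q, u) ≤ s_u · C(p + q, q)` for every `q < u < p`. -/
theorem shadowCumulative_of_series {p q : ℕ} (hn : (gr M).card = p + q) (hr : M.eRank = (p : ℕ∞))
    {S : Finset α} (hSE : (S : Set α) ⊆ M.E) (hser : ∀ x ∈ S, ∀ y ∈ S, x ≠ y → M.IsCocircuit {x, y})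
    (hnc : ∀ x ∈ S, ¬ M.IsColoop x) (hS2 : 2 ≤ S.card) (hk : S.card + q = p + 2) :
    ShadowCumulative M p q := by
  intro u hqu hup
  have hE0 := rk_ground_sdiff_of_series_degenerate M hr hSE hser hnc hS2 hk
  rw [card_shadowLev_of_series M hn hr hSE hser hnc hS2 hk le_rfl (by omega),
    card_shadowLev_of_series M hn hr hSE hser hnc hS2 hk hqu.le hup, Nat.sub_self, Nat.zero_add,
    Nat.choose_one_right]
  have hb := series_binom S.card q (by omega) (J := u - q) (by omega)
  have hn' : 2 * q + S.card - 2 = p + q := by omega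
  have hu' : q + (u - q) = u := by omega
  rw [hn', hu'] at hb
  calc (coreUp M p q S).card * S.card * (p + q).choose u
      = (coreUp M p q S).card * (S.card * (p + q).choose u) := by ring
    _ ≤ (coreUp M p q S).card * (S.card.choose (u - q + 1) * (p + q).choose q) :=
        Nat.mul_le_mul_left _ hb
    _ = (coreUp M p q S).card * S.card.choose (u - q + 1) * (p + q).choose q := by ring

/-- **C-025 HOLDS ON EVERY SERIES-DEGENERATE CELL**: `ThmN.RLS M p q` whenever `|E| = p + q`, `ρ(E) = p` and `M` has
a series class of `p − q + 2` elements without coloops. -/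
theorem rls_of_series {p q : ℕ} (hn : (gr M).card = p + q) (hr : M.eRank = (p : ℕ∞))
    {S : Finset α} (hSE : (S : Set α) ⊆ M.E) (hser : ∀ x ∈ S, ∀ y ∈ S, x ≠ y → M.IsCocircuit {x, y})
    (hnc : ∀ x ∈ S, ¬ M.IsColoop x) (hS2 : 2 ≤ S.card) (hk : S.card + q = p + 2) :
    ThmN.RLS M p q :=
  rls_of_shadowCumulative M p q (shadowCumulative_of_series M hn hr hSE hser hnc hS2 hk)

end PercRepro.RankDist
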